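import Summits.Ventures.HodgeKum4.Theses.KummerFixedLocus
import Summits.Ventures.HodgeKum4.Theorems.LaneVDefs
import Literature.AlgebraicGeometry.HilbertScheme.LefschetzDualTransfer
import Literature.AlgebraicGeometry.HilbertScheme.TransferOperatorSuperCommutators
import Literature.AlgebraicGeometry.Hyperkaehler.LLVGeneration
import Literature.AlgebraicGeometry.Motives.AbelianVarietyProjectiveChart
import Mathlib.LinearAlgebra.Trace
import HarnessLib

/-!
# V2 SKELETON — `LefschetzGenerationHilb n` for EVERY `n` along the V2 mechanism (CRUX-PLAN shape)

Planner hodge-kum4-plan g16, 2026-08-27 — part (iv) of the REV-20 PACKAGE (PREPARE-NOT-FILE).  Scratch file, not in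
the tree; nothing is filed.  Source of the mechanism: `HOME/plan/V2-MECHANISM.md` v1.1 (c1707e937011c3f2; hostile read
of record by ref g36 06:56:10Z: SURVIVES) and `HOME/plan/g16/v2/LANDING-PLAN-R3.md` (c7215cf0c6989fe9).

The target `LefschetzGenerationHilb n` and its vocabulary (`LefschetzGenerationHilbAt`, `transferDual`) are copied
VERBATIM from v0typer's `LaneVDefs.lean` (43100e6237ad044f, §2) because that file is not yet in the tree (p1 g3, F5);
(this version imports `Summits.Ventures.HodgeKum4.Theorems.LaneVDefs` and the route file; it elaborates once F5 has landed AND the route item `LefschetzGenerationHilb5` exists).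

## Shape (CRUX-PLAN (A)): three registered stubs + the kernel-checked composition

* `stub_full`      — V2 §1–§4 + the finite certificate (S2): **evaluation is full**.  For a subspace `W ⊆ H*(A^[n])`
                     containing `H^{≤3}`, cup-closed and `f_α`-stable, `W` is stable under EVERY single-weight two-point
                     operator `τ_k(φ)|ₙ = Σᵢ 𝔮_k(φ εᵢ) 𝔮₋ₖ(eᵢ)|ₙ` (`1 ≤ k ≤ n`) of every SUPERTRACELESS `φ ∈ 𝔤𝔩(H*(A))`
                     (loop superalgebra `𝔩^ℤ ∋ t^{−2i}⊗E, t^{−2i−1}⊗O`, `E ⊕ O = 𝔰𝔩(8|8)` by (S2) = veng's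
                     `LieCertificate.lean` data 7311c4564758121a; Vandermonde evaluation §4; `𝔊₀(x)|ₙ`, `f_α|ₙ` are such
                     operators by LQW-W Thm 4.6 (k = 0) — in tree as `ChernCharacterOperators.cupOperator_zero_eq_transferOp_super`
                     — and by `sl₂`-partner uniqueness).  LOAD-BEARING.
* `stub_units`     — V2 §6 (+ §5(a)): **joins connect all shapes**.  If `1_{A^[n]} ∈ W`, `W` is two-point-stable and
                     stable under Lehn's boundary operator `𝔡|ₙ = G₁(1_A, n) ∪ ·`, then every UNIT MONOMIAL
                     `𝔮_{l₁}(1_A)⋯𝔮_{l_r}(1_A)|0⟩` (`Σ lᵢ = n`) lies in `W` (number operators split shapes; the join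
                     coefficient `−ab` of `[[𝔡, 𝔮_a(1)], 𝔮_b(1)] = −ab 𝔮_{a+b}(1)` is the interface axiom `boundary_bracket`).
* `stub_polarise`  — V2 §5(b) + Nakajima–Grojnowski spanning: **cyclic unit monomials**.  A two-point-stable `W`
                     containing all unit monomials of weight `n` is all of `H*(A^[n])` (polarisation derivations
                     `1_A ↦ y` at one weight convert unit monomials into all Nakajima monomials, which span by the
                     interface axiom `IsHeisenbergRepresentation.cyclic`).
* `lefschetzGenerationHilb_allN_of` — the composition, PROVED (no sorry): the `⟨f_α, ∪⟩`-span of `H^{≤3}(A^[n])`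
  satisfies the closure hypotheses BY DEFINITION (`subset_opCupSpan`, `isCupClosed_opCupSpan`,
  `mem_stabilizerLie_opCupSpan`), contains `1` and is `𝔡`-stable (`G₁(1_A, n) ∈ H²` by `G_degree`), so the three
  stubs give `= ⊤` for every `n`.

Nothing here says L1-Hilb(n) ∕ L1 ∕ HC_Kum4Type is proved: the three stubs are `sorry`.
-/

noncomputable section

open CategoryTheory CategoryTheory.Limits
open scoped TensorProduct DirectSum
open Literature.AlgebraicTopology.SingularHomology
open Literature.AlgebraicGeometry Literature.AlgebraicGeometry.Hyperkaehler Literature.AlgebraicGeometry.HilbertScheme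
open Literature.AlgebraicGeometry.HodgeTheory (complexBetti)
open Literature.AlgebraicGeometry.Motives (AbelianVariety)

universe u


namespace Summit.Ventures.HodgeKum4.Cruxes.LefschetzGenerationHilb5.V2

open Summit.Ventures.HodgeKum4

variable {S : Motives.SchemeOver ℂ} {hS : Motives.IsSmoothProjective 2 S} {H : HilbertSchemesOfPoints S}

/-! ### The words of the line -/

/-- **The single-weight two-point operator `τ_k(φ)|ₙ = (Σᵢ 𝔮_k(φ εᵢ) 𝔮₋ₖ(eᵢ))|_{H*(S^[n])}`** of an endomorphism `φ`
of `H*(S(ℂ); ℂ)` at weight `k` (`HeisenbergFockSpace.transferTerm`, restricted to the summand `ℍₙ`): on letters it is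
the colour-changing derivation `𝔮_k(z) ↦ −k · 𝔮_k(φ z)` (V2-MECHANISM §1 (D), "`D[φ@k]`" up to the factor `−k`). -/
def twoPoint (𝔑 : NakajimaOperators hS H)
    (C : totalCohomology ℂ (Motives.ComplexPoints S) ⊗[ℂ] totalCohomology ℂ (Motives.ComplexPoints S))
    (φ : Module.End ℂ (totalCohomology ℂ (Motives.ComplexPoints S))) (k n : ℕ) :
    Module.End ℂ (totalCohomology ℂ (Motives.ComplexPoints (H.obj n))) :=
  restrictFock ℂ (fockFamily H) (transferTerm ℂ 𝔑.q C φ (k : ℤ)) n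

/-- **Supertrace zero** for an endomorphism of `H*(S(ℂ); ℂ)` of a surface: `Σ_{i ≤ 4} (−1)ⁱ tr(φ|_{Hⁱ → Hⁱ}) = 0`
(`Hⁱ = 0` for `i > 4`; e.g. `Id`: `χ_top(A) = 1 − 4 + 6 − 4 + 1 = 0`; every left multiplication `m_x`, `|x| > 0`;
the `sl₂`-partner `Λ_A`).  `𝔰𝔩(8|8) = E ⊕ O` of the certificate (S2) is the set of these. -/
def IsSuperTraceless (φ : Module.End ℂ (totalCohomology ℂ (Motives.ComplexPoints S))) : Prop :=
  ∑ i ∈ Finset.range 5, (-1 : ℂ) ^ i *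
      LinearMap.trace ℂ (complexBetti S i)
        (DirectSum.component ℂ ℕ (fun j ↦ complexBetti S j) i ∘ₗ φ ∘ₗ
          DirectSum.lof ℂ ℕ (fun j ↦ complexBetti S j) i) = 0

/-- **Two-point stability** of `W ⊆ H*(S^[n])`: stable under `τ_k(φ)|ₙ` for every supertraceless `φ` and every
weight `1 ≤ k ≤ n` (V2 §4: "`𝔩^(n) ⊇ ⊕_{k ≤ n} 𝔰𝔩(H*(A))@k`"). -/
def TwoPointStable (𝔑 : NakajimaOperators hS H)
    (C : totalCohomology ℂ (Motives.ComplexPoints S) ⊗[ℂ] totalCohomology ℂ (Motives.ComplexPoints S)) (n : ℕ)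
    (W : Submodule ℂ (totalCohomology ℂ (Motives.ComplexPoints (H.obj n)))) : Prop :=
  ∀ φ : Module.End ℂ (totalCohomology ℂ (Motives.ComplexPoints S)), IsSuperTraceless φ →
    ∀ k : ℕ, 1 ≤ k → k ≤ n → ∀ w ∈ W, twoPoint 𝔑 C φ k n w ∈ W

/-- **The lane-(V) closure hypotheses** that the `⟨f_α, ∪⟩`-span of `H^{≤3}(S^[n])` satisfies by definition:
contains every class of degree `≤ 3`, cup-closed, `f_α|ₙ`-stable. -/
structure IsLaneVClosed (𝔑 : NakajimaOperators hS H)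
    (C : totalCohomology ℂ (Motives.ComplexPoints S) ⊗[ℂ] totalCohomology ℂ (Motives.ComplexPoints S))
    (Λ_S : Module.End ℂ (totalCohomology ℂ (Motives.ComplexPoints S))) (n : ℕ)
    (W : Submodule ℂ (totalCohomology ℂ (Motives.ComplexPoints (H.obj n)))) : Prop where
  low_subset : degreeClasses ℂ (Motives.ComplexPoints (H.obj n)) {0, 1, 2, 3} ⊆ W
  cupClosed : IsCupClosed W
  dual_mem : transferDual 𝔑 C Λ_S n ∈ stabilizerLie W

/-- **Unit monomials** `𝔮_{l₁}(1_S) ⋯ 𝔮_{l_r}(1_S)|0⟩ ∈ ℍ` (V2 §5(b) `u_μ`, `μ = (l₁, …, l_r)`). -/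
def unitMonomial (𝔑 : NakajimaOperators hS H) (l : List ℕ) : fockSpace H :=
  (l.map fun m ↦ 𝔑.q (m : ℤ) (unitCoeff S)).prod (vacuumVector H)

/-- The `ℍₙ`-component of a Fock vector (`ℍₙ = H*(S^[n](ℂ); ℂ)`). -/
def summandOf (n : ℕ) : fockSpace H →ₗ[ℂ] totalCohomology ℂ (Motives.ComplexPoints (H.obj n)) :=
  DirectSum.component ℂ ℕ (fun p ↦ FockSummand (fockFamily H) p) n

/-! ### The three stub statements -/

/-- **STUB 1 statement (V2 §1–§4 + (S2)): evaluation is full.** -/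
def V2Full : Prop :=
  ∀ ⦃A : AbelianVariety ℂ⦄, A.dim = 2 → ∀ (hS : Motives.IsSmoothProjective 2 A.X) (H : HilbertSchemesOfPoints A.X)
    (𝔊 : ChernCharacterOperators hS H)
    (C : totalCohomology ℂ (Motives.ComplexPoints A.X) ⊗[ℂ] totalCohomology ℂ (Motives.ComplexPoints A.X)),
    C ∈ evenTensorSpan ℂ (coeffFamily A.X) → IsCasimir ℂ (poincarePairing hS) C →
    ∀ (α : complexBetti A.X 2) (Λ_A : Module.End ℂ (totalCohomology ℂ (Motives.ComplexPoints A.X))),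
      IsDualLefschetz 2 α Λ_A → ∀ (n : ℕ) (W : Submodule ℂ (totalCohomology ℂ (Motives.ComplexPoints (H.obj n)))),
        IsLaneVClosed 𝔊.toNakajimaOperators C Λ_A n W → TwoPointStable 𝔊.toNakajimaOperators C n W

/-- **STUB 2 statement (V2 §6 + §5(a)): joins connect all shapes.** -/
def V2Units : Prop :=
  ∀ ⦃A : AbelianVariety ℂ⦄, A.dim = 2 → ∀ (hS : Motives.IsSmoothProjective 2 A.X) (H : HilbertSchemesOfPoints A.X)
    (𝔊 : ChernCharacterOperators hS H)
    (C : totalCohomology ℂ (Motives.ComplexPoints A.X) ⊗[ℂ] totalCohomology ℂ (Motives.ComplexPoints A.X)),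
    C ∈ evenTensorSpan ℂ (coeffFamily A.X) → IsCasimir ℂ (poincarePairing hS) C →
    ∀ (n : ℕ) (W : Submodule ℂ (totalCohomology ℂ (Motives.ComplexPoints (H.obj n)))),
      ofDegree ℂ (Motives.ComplexPoints (H.obj n)) 0 (singularCohomology.one ℂ (Motives.ComplexPoints (H.obj n))) ∈ W →
      TwoPointStable 𝔊.toNakajimaOperators C n W →
      (∀ w ∈ W, totalCup ℂ (Motives.ComplexPoints (H.obj n)) (𝔊.G 1 n (unitCoeff A.X)) w ∈ W) →
        ∀ l : List ℕ, (∀ m ∈ l, 0 < m) → l.sum = n → summandOf n (unitMonomial 𝔊.toNakajimaOperators l) ∈ W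

/-- **STUB 3 statement (V2 §5(b) + Nakajima spanning): unit monomials polarise to everything.** -/
def V2Polarise : Prop :=
  ∀ ⦃A : AbelianVariety ℂ⦄, A.dim = 2 → ∀ (hS : Motives.IsSmoothProjective 2 A.X) (H : HilbertSchemesOfPoints A.X)
    (𝔊 : ChernCharacterOperators hS H)
    (C : totalCohomology ℂ (Motives.ComplexPoints A.X) ⊗[ℂ] totalCohomology ℂ (Motives.ComplexPoints A.X)),
    C ∈ evenTensorSpan ℂ (coeffFamily A.X) → IsCasimir ℂ (poincarePairing hS) C →
    ∀ (n : ℕ) (W : Submodule ℂ (totalCohomology ℂ (Motives.ComplexPoints (H.obj n)))),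
      TwoPointStable 𝔊.toNakajimaOperators C n W →
      (∀ l : List ℕ, (∀ m ∈ l, 0 < m) → l.sum = n → summandOf n (unitMonomial 𝔊.toNakajimaOperators l) ∈ W) →
        W = ⊤

/-! ### Registered stubs -/

/-- STUB 1 (LOAD-BEARING; size L): V2 §1 (D) derivation lemma for `𝔊₀(x)` (tree: `cupOperator_zero_eq_transferOp_super`)
and for `f_α` (`sl₂`-partner uniqueness, `Literature.Algebra.Lie.dualPartner_unique`), §2–§3 the loop superalgebra and the
finite certificate (S2) (`LieCertificate.lean`, landing by veng), §4 Vandermonde evaluation; plus "a subspace stable under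
Lie generators is stable under the generated Lie algebra". -/
theorem stub_full : V2Full := by
  sorry

/-- STUB 2 (size M): V2 §6 — the `𝔡`-joins `[[𝔡, 𝔮_a(1)], 𝔮_b(1)] = −ab 𝔮_{a+b}(1)` (interface axiom `boundary_bracket`)
move the unit monomial of shape `μ` to that of every merged shape with ONE sign; number operators `τ_k(Id)` (two-point,
`Id` supertraceless) separate shapes. -/
theorem stub_units : V2Units := by
  sorry

/-- STUB 3 (size M): V2 §5(b) — polarisation derivations `τ_k(y ⊗ δ_{1})` (supertraceless for `|y| > 0`) turn
`𝔮_{l₁}(1)⋯𝔮_{l_r}(1)|0⟩` into every `𝔮_{l₁}(y₁)⋯𝔮_{l_r}(y_r)|0⟩` with non-zero falling-factorial coefficients; these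
span `ℍₙ` by `IsHeisenbergRepresentation.cyclic` (weight-`n` part). -/
theorem stub_polarise : V2Polarise := by
  sorry

/-! ### The composition (kernel-checked) -/

/-- **L1-Hilb(n) for every `n` from the three stubs.** -/
theorem lefschetzGenerationHilb_allN_of (h₁ : V2Full) (h₂ : V2Units) (h₃ : V2Polarise) (n : ℕ) :
    LefschetzGenerationHilb n := by
  intro A hA hS H 𝔊 C hCg hC α Λ_A hΛ
  unfold LefschetzGenerationHilbAt
  set W := opCupSpan ℂ (Motives.ComplexPoints (H.obj n)) (transferDual 𝔊.toNakajimaOperators C Λ_A n)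
    (degreeClasses ℂ (Motives.ComplexPoints (H.obj n)) {0, 1, 2, 3}) with hW
  have hcl : IsLaneVClosed 𝔊.toNakajimaOperators C Λ_A n W :=
    ⟨subset_opCupSpan, isCupClosed_opCupSpan, mem_stabilizerLie_opCupSpan⟩
  have hT : TwoPointStable 𝔊.toNakajimaOperators C n W := h₁ hA hS H 𝔊 C hCg hC α Λ_A hΛ n W hcl
  -- `1_{A^[n]} ∈ W`
  have h1 : ofDegree ℂ (Motives.ComplexPoints (H.obj n)) 0
      (singularCohomology.one ℂ (Motives.ComplexPoints (H.obj n))) ∈ W :=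
    hcl.low_subset (ofDegree_mem_degreeClasses (by simp) _)
  -- `G₁(1_A, n) ∈ H²(A^[n]) ⊆ W`, so `W` is `𝔡|ₙ`-stable by cup-closedness
  have hG1 : 𝔊.G 1 n (unitCoeff A.X) ∈ W := by
    obtain ⟨d, hd⟩ := 𝔊.G_degree 1 n 0 (singularCohomology.one ℂ (Motives.ComplexPoints A.X))
    have hd' : ofDegree ℂ (Motives.ComplexPoints (H.obj n)) (0 + 2 * 1) d = 𝔊.G 1 n (unitCoeff A.X) := hd
    rw [← hd']
    exact hcl.low_subset (ofDegree_mem_degreeClasses (by norm_num) d)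
  have h𝔡 : ∀ w ∈ W, totalCup ℂ (Motives.ComplexPoints (H.obj n)) (𝔊.G 1 n (unitCoeff A.X)) w ∈ W :=
    fun w hw ↦ hcl.cupClosed _ hG1 w hw
  have hU := h₂ hA hS H 𝔊 C hCg hC n W h1 hT h𝔡
  exact h₃ hA hS H 𝔊 C hCg hC n W hT hU

/-- **Composition for the route item** `LefschetzGenerationHilb5` (= `LefschetzGenerationHilbW 5` after the (ρ3) restate —
the weakest form the lane-(V) feeder consumes: L1-Hilb(5) for Chern character operators satisfying the LQW `W` zero-mode
identities `IsWZeroModes`), concluded BY NAME from the three registered stubs: the all-`n`, all-instance theorem specialised at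
`n = 5` and weakened along `lefschetzGenerationHilbW_of_hilb` (the three stubs depend on `𝔊` only through `𝔮` and
`boundary_bracket`, so they are instance-invariant and unchanged). -/
theorem LefschetzGenerationHilb5_of : Summit.Ventures.HodgeKum4.Theses.KummerFixedLocus.LefschetzGenerationHilb5 :=
  lefschetzGenerationHilbW_of_hilb (lefschetzGenerationHilb_allN_of stub_full stub_units stub_polarise 5)

end Summit.Ventures.HodgeKum4.Cruxes.LefschetzGenerationHilb5.V2

end
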